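import Mathlib.MeasureTheory.Measure.Haar.InnerProductSpace
import Mathlib.Analysis.InnerProductSpace.Projection.Reflection
import Mathlib.MeasureTheory.Integral.Bochner.Basic
import HarnessLib

/-!
# Radial symmetry of weighted velocity moments on `ℝ³` for the K2R refutation line

Route `EnskogAdjointDuality` of `AtomisticToContinuum/HydrodynamicLimit`, crux K2R
(`AdjointEnskogTestFamilyR`, stmt-AtomisticToContinuum-11592), line `refutation`, registered stub
`stub_radialSymmetry`.

For a radial weight `v ↦ ϑ(|v|²)` on `ℝ³ = EuclideanSpace ℝ (Fin 3)` (`ϑ` continuous with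
`|ϑ(|v|²)| (1 + |v|²)³ ∈ L¹`) and a continuous profile `P` of cubic growth, all the elementary
symmetries of the Lebesgue moments used by the assembly:

* odd moments vanish: `∫ ϑ vⱼ = ∫ ϑ vⱼ|v|² = ∫ ϑ vᵢvⱼ = ∫ ϑ vᵢ²vⱼ = ∫ ϑ v₀³ = ∫ ϑ vⱼ P(v₀) = 0`
  (`i ≠ j`, `j ≠ 0` in the last one);
* equipartition `∫ ϑ vⱼ² = ⅓ ∫ ϑ |v|²`;
* rotation to the pole: for a unit vector `ω`, `∫ ϑ P(v·ω) = ∫ ϑ P(v₀)` and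
  `∫ ϑ v₀ P(v·ω) = ω₀ ∫ ϑ v₀ P(v₀)`;
* the integrability of every integrand met (domination by `|ϑ(|v|²)| (1 + |v|²)³`).

Everything is invariance of Lebesgue measure under linear isometries
(`LinearIsometryEquiv.measurePreserving`): an integrand odd under ONE isometry has integral zero
(`k2r_ref_rs_integral_eq_zero_of_odd`), applied to the flip of one coordinate
(`k2r_ref_rs_exists_flip`); the swap of two coordinates (`k2r_ref_rs_exists_swap`) gives
equipartition; the reflection taking `e₀` to `ω` (`k2r_ref_rs_exists_toPole`, Mathlib's
`Submodule.reflection_sub`) gives the pole formulas. No sphere measure / polar coordinates here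
(those are the neighbouring `…SphereCalculus*` files). [folklore]
-/

noncomputable section

open MeasureTheory Set Filter
open scoped InnerProductSpace Real

namespace Summit.AtomisticToContinuum.HydrodynamicLimit.Theorems.EnskogAdjointDuality

/-! ### Linear isometries of `ℝ³` and Lebesgue integrals -/

/-- Substitution rule: `∫ f(A v) dv = ∫ f(v) dv` for a linear isometry `A` of `ℝ³` (Lebesgue
measure is `A`-invariant). [folklore] -/
theorem k2r_ref_rs_integral_comp
    (A : EuclideanSpace ℝ (Fin 3) ≃ₗᵢ[ℝ] EuclideanSpace ℝ (Fin 3)) (f : EuclideanSpace ℝ (Fin 3) → ℝ) :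
    ∫ v, f (A v) = ∫ v, f v :=
  A.measurePreserving.integral_comp A.toHomeomorph.measurableEmbedding f

/-- An integrand odd under one linear isometry `A` of `ℝ³` (`f (A v) = -f v`) has integral zero
(no integrability needed). [folklore] -/
theorem k2r_ref_rs_integral_eq_zero_of_odd
    (A : EuclideanSpace ℝ (Fin 3) ≃ₗᵢ[ℝ] EuclideanSpace ℝ (Fin 3)) {f : EuclideanSpace ℝ (Fin 3) → ℝ}
    (hf : ∀ v, f (A v) = -f v) : ∫ v, f v = 0 := by
  have h := k2r_ref_rs_integral_comp A f
  simp only [hf, integral_neg] at h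
  linarith

/-- **Flip of one coordinate**: the linear isometry of `ℝ³` negating the `j`-th coordinate and
fixing the others. [folklore] -/
theorem k2r_ref_rs_exists_flip (j : Fin 3) :
    ∃ S : EuclideanSpace ℝ (Fin 3) ≃ₗᵢ[ℝ] EuclideanSpace ℝ (Fin 3),
      ∀ v, S v j = -v j ∧ ∀ i, i ≠ j → S v i = v i :=
  ⟨LinearIsometryEquiv.piLpCongrRight 2 fun i =>
      if i = j then LinearIsometryEquiv.neg ℝ else LinearIsometryEquiv.refl ℝ ℝ,
    fun v => ⟨by simp, fun i hi => by simp [hi]⟩⟩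

/-- **Swap of two coordinates**: a linear isometry `T` of `ℝ³` with `(T v)₀ = vⱼ`. [folklore] -/
theorem k2r_ref_rs_exists_swap (j : Fin 3) :
    ∃ T : EuclideanSpace ℝ (Fin 3) ≃ₗᵢ[ℝ] EuclideanSpace ℝ (Fin 3), ∀ v, T v 0 = v j :=
  ⟨LinearIsometryEquiv.piLpCongrLeft 2 ℝ ℝ (Equiv.swap 0 j), fun v => by
    simp [Equiv.piCongrLeft'_apply, Equiv.swap_apply_left]⟩

/-- **Rotation to the pole**: for a unit vector `ω` of `ℝ³` there is a linear isometry `A` (the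
reflection exchanging `e₀` and `ω`) with `⟪A u, ω⟫ = u₀` and `(A u)₀ = ⟪ω, u⟫ = Σ ωᵢ uᵢ`. [folklore] -/
theorem k2r_ref_rs_exists_toPole (ω : Metric.sphere (0 : EuclideanSpace ℝ (Fin 3)) 1) :
    ∃ A : EuclideanSpace ℝ (Fin 3) ≃ₗᵢ[ℝ] EuclideanSpace ℝ (Fin 3),
      (∀ u, inner ℝ (A u) (ω : EuclideanSpace ℝ (Fin 3)) = u 0) ∧
      ∀ u, A u 0 = (ω : EuclideanSpace ℝ (Fin 3)) 0 * u 0 + (ω : EuclideanSpace ℝ (Fin 3)) 1 * u 1 +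
        (ω : EuclideanSpace ℝ (Fin 3)) 2 * u 2 := by
  set e₀ : EuclideanSpace ℝ (Fin 3) := EuclideanSpace.single 0 (1 : ℝ) with he₀
  set R : EuclideanSpace ℝ (Fin 3) ≃ₗᵢ[ℝ] EuclideanSpace ℝ (Fin 3) :=
    (ℝ ∙ (e₀ - (ω : EuclideanSpace ℝ (Fin 3))))ᗮ.reflection with hRdef
  have hR : R e₀ = ω := Submodule.reflection_sub (by simp [he₀, norm_eq_of_mem_sphere ω])
  have hinner : ∀ u : EuclideanSpace ℝ (Fin 3), inner ℝ u e₀ = u 0 := fun u => by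
    simp [he₀, EuclideanSpace.inner_single_right]
  refine ⟨R, fun u => ?_, fun u => ?_⟩
  · rw [← hR, LinearIsometryEquiv.inner_map_map, hinner]
  · rw [← hinner, ← Submodule.reflection_reflection (ℝ ∙ (e₀ - (ω : EuclideanSpace ℝ (Fin 3))))ᗮ e₀]
    change inner ℝ (R u) (R (R e₀)) = _
    rw [LinearIsometryEquiv.inner_map_map, hR]
    simp [PiLp.inner_apply, Fin.sum_univ_three, mul_comm]

/-! ### Domination by `|ϑ(|v|²)| (1 + |v|²)³` -/

/-- `(1 + t)⁴ ≤ 4 (1 + t²)³` for `t ≥ 0`. [folklore] -/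
theorem k2r_ref_rs_one_add_pow_four_le (t : ℝ) (ht : 0 ≤ t) :
    (1 + t) ^ 4 ≤ 4 * (1 + t ^ 2) ^ 3 := by
  have h1 : (1 + t) ^ 2 ≤ 2 * (1 + t ^ 2) := by nlinarith [sq_nonneg (t - 1)]
  calc (1 + t) ^ 4 = ((1 + t) ^ 2) ^ 2 := by ring
    _ ≤ (2 * (1 + t ^ 2)) ^ 2 := pow_le_pow_left₀ (by positivity) h1 2
    _ = 4 * (1 + t ^ 2) ^ 2 := by ring
    _ ≤ 4 * (1 + t ^ 2) ^ 3 := by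
      have h2 : (1 + t ^ 2) ^ 2 ≤ (1 + t ^ 2) ^ 3 :=
        pow_le_pow_right₀ (by nlinarith) (by norm_num)
      linarith

/-- `tᵏ ≤ (1 + t²)³` for `t ≥ 0` and `k ≤ 3`. [folklore] -/
theorem k2r_ref_rs_pow_le (t : ℝ) (ht : 0 ≤ t) {k : ℕ} (hk : k ≤ 3) : t ^ k ≤ (1 + t ^ 2) ^ 3 := by
  have h1 : t ≤ 1 + t ^ 2 := by nlinarith [sq_nonneg (t - 1)]
  calc t ^ k ≤ (1 + t ^ 2) ^ k := pow_le_pow_left₀ ht h1 k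
    _ ≤ (1 + t ^ 2) ^ 3 := pow_le_pow_right₀ (by nlinarith) hk

/-- Domination: a continuous `F` with `|F(v)| ≤ C |ϑ(|v|²)| (1 + |v|²)³` is integrable as soon as
`|ϑ(|v|²)| (1 + |v|²)³` is. [folklore] -/
theorem k2r_ref_rs_integrable_of_le {ϑ : ℝ → ℝ}
    (hD : Integrable (fun v : EuclideanSpace ℝ (Fin 3) => |ϑ (‖v‖ ^ 2)| * (1 + ‖v‖ ^ 2) ^ 3))
    {F : EuclideanSpace ℝ (Fin 3) → ℝ} (hF : Continuous F) (C : ℝ)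
    (hle : ∀ v, |F v| ≤ C * (|ϑ (‖v‖ ^ 2)| * (1 + ‖v‖ ^ 2) ^ 3)) : Integrable F :=
  (hD.const_mul C).mono' hF.aestronglyMeasurable
    (ae_of_all _ fun v => by rw [Real.norm_eq_abs]; exact hle v)

/-- Domination, monomial form: a continuous `F` with `|F(v)| ≤ |ϑ(|v|²)| |v|ᵏ`, `k ≤ 3`, is
integrable. [folklore] -/
theorem k2r_ref_rs_integrable_of_le_pow {ϑ : ℝ → ℝ}
    (hD : Integrable (fun v : EuclideanSpace ℝ (Fin 3) => |ϑ (‖v‖ ^ 2)| * (1 + ‖v‖ ^ 2) ^ 3))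
    {F : EuclideanSpace ℝ (Fin 3) → ℝ} (hF : Continuous F) {k : ℕ} (hk : k ≤ 3)
    (hle : ∀ v, |F v| ≤ |ϑ (‖v‖ ^ 2)| * ‖v‖ ^ k) : Integrable F :=
  k2r_ref_rs_integrable_of_le hD hF 1 fun v => (hle v).trans (by
    rw [one_mul]
    exact mul_le_mul_of_nonneg_left (k2r_ref_rs_pow_le ‖v‖ (norm_nonneg v) hk) (abs_nonneg _))

/-- Domination, profile form: `ϑ(|v|²) b(v) P(a(v))` is integrable for continuous `a`, `b` with
`|a(v)| ≤ |v|`, `|b(v)| ≤ 1 + |v|` and `P` continuous of cubic growth. [folklore] -/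
theorem k2r_ref_rs_integrable_profile {ϑ P : ℝ → ℝ} {CP : ℝ} (hϑ : Continuous ϑ)
    (hP : Continuous P) (hPle : ∀ a, |P a| ≤ CP * (1 + |a|) ^ 3)
    (hD : Integrable (fun v : EuclideanSpace ℝ (Fin 3) => |ϑ (‖v‖ ^ 2)| * (1 + ‖v‖ ^ 2) ^ 3))
    {a b : EuclideanSpace ℝ (Fin 3) → ℝ} (ha : Continuous a) (hb : Continuous b)
    (hale : ∀ v, |a v| ≤ ‖v‖) (hble : ∀ v, |b v| ≤ 1 + ‖v‖) :
    Integrable (fun v : EuclideanSpace ℝ (Fin 3) => ϑ (‖v‖ ^ 2) * b v * P (a v)) := by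
  have hCP : 0 ≤ CP := by
    have h := hPle 0
    simp only [abs_zero, add_zero, one_pow, mul_one] at h
    exact (abs_nonneg _).trans h
  refine k2r_ref_rs_integrable_of_le hD (by fun_prop) (4 * CP) fun v => ?_
  have hav := hale v
  have hbv := hble v
  have h1 : |P (a v)| ≤ CP * (1 + ‖v‖) ^ 3 := (hPle (a v)).trans (by gcongr)
  have h4 := k2r_ref_rs_one_add_pow_four_le ‖v‖ (norm_nonneg v)
  rw [abs_mul, abs_mul]
  calc |ϑ (‖v‖ ^ 2)| * |b v| * |P (a v)|
      ≤ |ϑ (‖v‖ ^ 2)| * (1 + ‖v‖) * (CP * (1 + ‖v‖) ^ 3) := by gcongr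
    _ = CP * (|ϑ (‖v‖ ^ 2)| * (1 + ‖v‖) ^ 4) := by ring
    _ ≤ CP * (|ϑ (‖v‖ ^ 2)| * (4 * (1 + ‖v‖ ^ 2) ^ 3)) := by gcongr
    _ = 4 * CP * (|ϑ (‖v‖ ^ 2)| * (1 + ‖v‖ ^ 2) ^ 3) := by ring

/-! ### The registered stub -/

/-- **Registered stub `stub_radialSymmetry`** (line `refutation` of crux K2R
`Summit.AtomisticToContinuum.HydrodynamicLimit.Theses.EnskogAdjointDuality.AdjointEnskogTestFamilyR`):
for a radial weight `ϑ(|v|²)` on `ℝ³` and a continuous profile `P` of cubic growth — vanishing of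
the odd moments, equipartition `∫ ϑ vⱼ² = ⅓ ∫ ϑ |v|²`, the rotation of `P(v·ω)` to the pole
`P(v₀)`, and the integrability of all integrands met; verbatim registered signature. [folklore] -/
theorem stub_radialSymmetry :
  ∀ (ϑ P : ℝ → ℝ) (CP : ℝ), Continuous ϑ → Continuous P → (∀ a, |P a| ≤ CP * (1 + |a|) ^ 3) →
    Integrable (fun v : EuclideanSpace ℝ (Fin 3) => |ϑ (‖v‖ ^ 2)| * (1 + ‖v‖ ^ 2) ^ 3) →
    (∀ j : Fin 3, Integrable (fun v : EuclideanSpace ℝ (Fin 3) => ϑ (‖v‖ ^ 2) * v j * ‖v‖ ^ 2) ∧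
      ∫ v : EuclideanSpace ℝ (Fin 3), ϑ (‖v‖ ^ 2) * v j = 0 ∧
      ∫ v : EuclideanSpace ℝ (Fin 3), ϑ (‖v‖ ^ 2) * v j * ‖v‖ ^ 2 = 0 ∧
      ∫ v : EuclideanSpace ℝ (Fin 3), ϑ (‖v‖ ^ 2) * v j ^ 2 =
        (1 / 3 : ℝ) * ∫ v : EuclideanSpace ℝ (Fin 3), ϑ (‖v‖ ^ 2) * ‖v‖ ^ 2) ∧
    (∀ i j : Fin 3, i ≠ j → Integrable (fun v : EuclideanSpace ℝ (Fin 3) => ϑ (‖v‖ ^ 2) * v i * v j) ∧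
      ∫ v : EuclideanSpace ℝ (Fin 3), ϑ (‖v‖ ^ 2) * v i * v j = 0 ∧
      ∫ v : EuclideanSpace ℝ (Fin 3), ϑ (‖v‖ ^ 2) * v i ^ 2 * v j = 0) ∧
    (∫ v : EuclideanSpace ℝ (Fin 3), ϑ (‖v‖ ^ 2) * v 0 ^ 3 = 0) ∧
    (∀ (ω : Metric.sphere (0 : EuclideanSpace ℝ (Fin 3)) 1),
      Integrable (fun v : EuclideanSpace ℝ (Fin 3) =>
        ϑ (‖v‖ ^ 2) * P (inner ℝ v (ω : EuclideanSpace ℝ (Fin 3)))) ∧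
      Integrable (fun v : EuclideanSpace ℝ (Fin 3) =>
        ϑ (‖v‖ ^ 2) * v 0 * P (inner ℝ v (ω : EuclideanSpace ℝ (Fin 3)))) ∧
      (∫ v : EuclideanSpace ℝ (Fin 3), ϑ (‖v‖ ^ 2) * P (inner ℝ v (ω : EuclideanSpace ℝ (Fin 3)))) =
        ∫ v : EuclideanSpace ℝ (Fin 3), ϑ (‖v‖ ^ 2) * P (v 0) ∧
      (∫ v : EuclideanSpace ℝ (Fin 3), ϑ (‖v‖ ^ 2) * v 0 * P (inner ℝ v (ω : EuclideanSpace ℝ (Fin 3)))) =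
        (ω : EuclideanSpace ℝ (Fin 3)) 0 * ∫ v : EuclideanSpace ℝ (Fin 3), ϑ (‖v‖ ^ 2) * v 0 * P (v 0) ∧
      (∀ j : Fin 3, j ≠ 0 → ∫ v : EuclideanSpace ℝ (Fin 3), ϑ (‖v‖ ^ 2) * v j * P (v 0) = 0)) := by
  intro ϑ P CP hϑ hP hPle hD
  have hc : ∀ (v : EuclideanSpace ℝ (Fin 3)) (i : Fin 3), |v i| ≤ ‖v‖ := fun v i => by
    simpa using PiLp.norm_apply_le v i
  -- integrability of the polynomial moments
  have hI1 : ∀ j : Fin 3,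
      Integrable (fun v : EuclideanSpace ℝ (Fin 3) => ϑ (‖v‖ ^ 2) * v j * ‖v‖ ^ 2) := fun j =>
    k2r_ref_rs_integrable_of_le_pow hD (by fun_prop) le_rfl fun v => by
      have hvj := hc v j
      rw [abs_mul, abs_mul, abs_pow, abs_norm, mul_assoc]
      gcongr
      calc |v j| * ‖v‖ ^ 2 ≤ ‖v‖ * ‖v‖ ^ 2 := by gcongr
        _ = ‖v‖ ^ 3 := by ring
  have hI2 : ∀ j : Fin 3,
      Integrable (fun v : EuclideanSpace ℝ (Fin 3) => ϑ (‖v‖ ^ 2) * v j ^ 2) := fun j =>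
    k2r_ref_rs_integrable_of_le_pow hD (by fun_prop) (by norm_num : 2 ≤ 3) fun v => by
      have hvj := hc v j
      rw [abs_mul, abs_pow]
      gcongr
  have hI4 : ∀ i j : Fin 3,
      Integrable (fun v : EuclideanSpace ℝ (Fin 3) => ϑ (‖v‖ ^ 2) * v i * v j) := fun i j =>
    k2r_ref_rs_integrable_of_le_pow hD (by fun_prop) (by norm_num : 2 ≤ 3) fun v => by
      have hvi := hc v i
      have hvj := hc v j
      rw [abs_mul, abs_mul, mul_assoc, pow_two]
      gcongr
  -- integrability of the profile moments
  have hI5 : ∀ ω : Metric.sphere (0 : EuclideanSpace ℝ (Fin 3)) 1,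
      Integrable (fun v : EuclideanSpace ℝ (Fin 3) =>
        ϑ (‖v‖ ^ 2) * P (inner ℝ v (ω : EuclideanSpace ℝ (Fin 3)))) := fun ω => by
    have h := k2r_ref_rs_integrable_profile hϑ hP hPle hD
      (a := fun v => inner ℝ v (ω : EuclideanSpace ℝ (Fin 3))) (b := fun _ => (1 : ℝ))
      (by fun_prop) (by fun_prop)
      (fun v => (abs_real_inner_le_norm v _).trans_eq (by rw [norm_eq_of_mem_sphere ω, mul_one]))
      (fun v => by rw [abs_one]; exact le_add_of_nonneg_right (norm_nonneg v))
    simpa only [mul_one] using h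
  have hI6 : ∀ ω : Metric.sphere (0 : EuclideanSpace ℝ (Fin 3)) 1,
      Integrable (fun v : EuclideanSpace ℝ (Fin 3) =>
        ϑ (‖v‖ ^ 2) * v 0 * P (inner ℝ v (ω : EuclideanSpace ℝ (Fin 3)))) := fun ω =>
    k2r_ref_rs_integrable_profile hϑ hP hPle hD
      (a := fun v => inner ℝ v (ω : EuclideanSpace ℝ (Fin 3))) (b := fun v => v 0)
      (by fun_prop) (by fun_prop)
      (fun v => (abs_real_inner_le_norm v _).trans_eq (by rw [norm_eq_of_mem_sphere ω, mul_one]))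
      (fun v => (hc v 0).trans (le_add_of_nonneg_left zero_le_one))
  have hI7 : ∀ j : Fin 3,
      Integrable (fun v : EuclideanSpace ℝ (Fin 3) => ϑ (‖v‖ ^ 2) * v j * P (v 0)) := fun j =>
    k2r_ref_rs_integrable_profile hϑ hP hPle hD (a := fun v => v 0) (b := fun v => v j)
      (by fun_prop) (by fun_prop) (fun v => hc v 0)
      (fun v => (hc v j).trans (le_add_of_nonneg_left zero_le_one))
  -- odd moments vanish (flip of the `j`-th coordinate)
  have h1b : ∀ j : Fin 3, ∫ v : EuclideanSpace ℝ (Fin 3), ϑ (‖v‖ ^ 2) * v j = 0 := fun j => by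
    obtain ⟨S, hS⟩ := k2r_ref_rs_exists_flip j
    refine k2r_ref_rs_integral_eq_zero_of_odd S fun v => ?_
    rw [S.norm_map, (hS v).1]
    ring
  have h1c : ∀ j : Fin 3,
      ∫ v : EuclideanSpace ℝ (Fin 3), ϑ (‖v‖ ^ 2) * v j * ‖v‖ ^ 2 = 0 := fun j => by
    obtain ⟨S, hS⟩ := k2r_ref_rs_exists_flip j
    refine k2r_ref_rs_integral_eq_zero_of_odd S fun v => ?_
    rw [S.norm_map, (hS v).1]
    ring
  have h2b : ∀ i j : Fin 3, i ≠ j →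
      ∫ v : EuclideanSpace ℝ (Fin 3), ϑ (‖v‖ ^ 2) * v i * v j = 0 := fun i j hij => by
    obtain ⟨S, hS⟩ := k2r_ref_rs_exists_flip j
    refine k2r_ref_rs_integral_eq_zero_of_odd S fun v => ?_
    rw [S.norm_map, (hS v).1, (hS v).2 i hij]
    ring
  have h2c : ∀ i j : Fin 3, i ≠ j →
      ∫ v : EuclideanSpace ℝ (Fin 3), ϑ (‖v‖ ^ 2) * v i ^ 2 * v j = 0 := fun i j hij => by
    obtain ⟨S, hS⟩ := k2r_ref_rs_exists_flip j
    refine k2r_ref_rs_integral_eq_zero_of_odd S fun v => ?_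
    rw [S.norm_map, (hS v).1, (hS v).2 i hij]
    ring
  have h3 : ∫ v : EuclideanSpace ℝ (Fin 3), ϑ (‖v‖ ^ 2) * v 0 ^ 3 = 0 := by
    obtain ⟨S, hS⟩ := k2r_ref_rs_exists_flip 0
    refine k2r_ref_rs_integral_eq_zero_of_odd S fun v => ?_
    rw [S.norm_map, (hS v).1]
    ring
  have h4e : ∀ j : Fin 3, j ≠ 0 →
      ∫ v : EuclideanSpace ℝ (Fin 3), ϑ (‖v‖ ^ 2) * v j * P (v 0) = 0 := fun j hj => by
    obtain ⟨S, hS⟩ := k2r_ref_rs_exists_flip j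
    refine k2r_ref_rs_integral_eq_zero_of_odd S fun v => ?_
    rw [S.norm_map, (hS v).1, (hS v).2 0 hj.symm]
    ring
  -- equipartition (swap of two coordinates)
  have hm : ∀ j : Fin 3, ∫ v : EuclideanSpace ℝ (Fin 3), ϑ (‖v‖ ^ 2) * v j ^ 2 =
      ∫ v : EuclideanSpace ℝ (Fin 3), ϑ (‖v‖ ^ 2) * v 0 ^ 2 := fun j => by
    obtain ⟨T, hT⟩ := k2r_ref_rs_exists_swap j
    rw [← k2r_ref_rs_integral_comp T (fun v => ϑ (‖v‖ ^ 2) * v 0 ^ 2)]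
    simp only [T.norm_map, hT]
  have hsum : ∫ v : EuclideanSpace ℝ (Fin 3), ϑ (‖v‖ ^ 2) * ‖v‖ ^ 2 =
      3 * ∫ v : EuclideanSpace ℝ (Fin 3), ϑ (‖v‖ ^ 2) * v 0 ^ 2 := by
    have h : ∀ v : EuclideanSpace ℝ (Fin 3), ϑ (‖v‖ ^ 2) * ‖v‖ ^ 2 =
        ϑ (‖v‖ ^ 2) * v 0 ^ 2 + ϑ (‖v‖ ^ 2) * v 1 ^ 2 + ϑ (‖v‖ ^ 2) * v 2 ^ 2 := fun v => by
      have h' := EuclideanSpace.real_norm_sq_eq v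
      rw [Fin.sum_univ_three] at h'
      linear_combination ϑ (‖v‖ ^ 2) * h'
    simp_rw [h]
    rw [integral_add ?_ (hI2 2), integral_add (hI2 0) (hI2 1), hm 1, hm 2]
    · ring
    · exact (hI2 0).add (hI2 1)
  have h1d : ∀ j : Fin 3, ∫ v : EuclideanSpace ℝ (Fin 3), ϑ (‖v‖ ^ 2) * v j ^ 2 =
      (1 / 3 : ℝ) * ∫ v : EuclideanSpace ℝ (Fin 3), ϑ (‖v‖ ^ 2) * ‖v‖ ^ 2 := fun j => by
    rw [hm j, hsum]
    ring
  -- rotation to the pole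
  have h4c : ∀ ω : Metric.sphere (0 : EuclideanSpace ℝ (Fin 3)) 1,
      (∫ v : EuclideanSpace ℝ (Fin 3), ϑ (‖v‖ ^ 2) * P (inner ℝ v (ω : EuclideanSpace ℝ (Fin 3)))) =
        ∫ v : EuclideanSpace ℝ (Fin 3), ϑ (‖v‖ ^ 2) * P (v 0) := fun ω => by
    obtain ⟨A, hA1, -⟩ := k2r_ref_rs_exists_toPole ω
    rw [← k2r_ref_rs_integral_comp A
      (fun v => ϑ (‖v‖ ^ 2) * P (inner ℝ v (ω : EuclideanSpace ℝ (Fin 3))))]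
    simp only [A.norm_map, hA1]
  have h4d : ∀ ω : Metric.sphere (0 : EuclideanSpace ℝ (Fin 3)) 1,
      (∫ v : EuclideanSpace ℝ (Fin 3),
          ϑ (‖v‖ ^ 2) * v 0 * P (inner ℝ v (ω : EuclideanSpace ℝ (Fin 3)))) =
        (ω : EuclideanSpace ℝ (Fin 3)) 0 *
          ∫ v : EuclideanSpace ℝ (Fin 3), ϑ (‖v‖ ^ 2) * v 0 * P (v 0) := fun ω => by
    obtain ⟨A, hA1, hA2⟩ := k2r_ref_rs_exists_toPole ω
    rw [← k2r_ref_rs_integral_comp A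
      (fun v => ϑ (‖v‖ ^ 2) * v 0 * P (inner ℝ v (ω : EuclideanSpace ℝ (Fin 3))))]
    have hsplit : ∀ u : EuclideanSpace ℝ (Fin 3),
        ϑ (‖A u‖ ^ 2) * A u 0 * P (inner ℝ (A u) (ω : EuclideanSpace ℝ (Fin 3))) =
          (ω : EuclideanSpace ℝ (Fin 3)) 0 * (ϑ (‖u‖ ^ 2) * u 0 * P (u 0)) +
            (ω : EuclideanSpace ℝ (Fin 3)) 1 * (ϑ (‖u‖ ^ 2) * u 1 * P (u 0)) +
            (ω : EuclideanSpace ℝ (Fin 3)) 2 * (ϑ (‖u‖ ^ 2) * u 2 * P (u 0)) := fun u => by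
      rw [A.norm_map, hA1, hA2]
      ring
    simp_rw [hsplit]
    rw [integral_add ?_ ((hI7 2).const_mul _), integral_add ((hI7 0).const_mul _)
      ((hI7 1).const_mul _), integral_const_mul, integral_const_mul, integral_const_mul,
      h4e 1 (by decide), h4e 2 (by decide)]
    · ring
    · exact ((hI7 0).const_mul _).add ((hI7 1).const_mul _)
  exact ⟨fun j => ⟨hI1 j, h1b j, h1c j, h1d j⟩, fun i j hij => ⟨hI4 i j, h2b i j hij, h2c i j hij⟩,
    h3, fun ω => ⟨hI5 ω, hI6 ω, h4c ω, h4d ω, h4e⟩⟩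

end Summit.AtomisticToContinuum.HydrodynamicLimit.Theorems.EnskogAdjointDuality
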